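import Mathlib
import Summits.CriticalPhenomena.SAWScalingLimit.Theorems.SAWDevelopingMapSourceLoopBoundSourceLaw

/-!
# Walks at a walled vertex: first arrivals prolonged through the vertex

Helper file (walk combinatorics) for the crux `NoFoldBound` (stmt-CriticalPhenomena-8296) of the
route `SAWDevelopingMap` (sub-problem `SAWScalingLimit` of `CriticalPhenomena`), line
`Ideator3Sketch`, stub `stub_walledPorts` (the port decomposition of the SAW parafermionic
observable at a walled vertex, file `SAWDevelopingMapNoFoldBoundWalledPorts.lean`).

Setting (Duminil-Copin–Smirnov 2012, §2): a finite vertex set `Λ` of the hexagonal lattice `ℍ`,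
a source mid-edge `a`, a vertex `v ∈ Λ` off `a` with a neighbour `u ∉ Λ` (the port `{v, u}` is
*walled*) and the two other neighbours `w₁, w₂` of `v`.  A *first arrival* at `v` through `w` is
a self-avoiding walk from `a` to the mid-edge `{v, w}` not visiting `v` (its last vertex is `w`).

* `snoc_*`: a first arrival through `w` followed by the vertex `v` is a walk from `a` to any other
  port `{v, t}`, `t ≠ w`; `weight_mk_concat`: its weight is
  `x e^{-iσ W(mid{w,v} → c(v) → mid{v,t})}` times the weight of the first arrival (the length
  grows by one, the winding by the turn at `v`: the last half-segment of the first arrival is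
  collinear with the edge `w v`).
* `exists_init`: conversely a walk to `{v, t}` ending at `v` is such a prolongation, through a
  neighbour `y ∈ Λ` of `v` with `y ≠ t` (no U-turn on the final mid-edge).
* `exists_eq_concat_out`: a walk to the walled port `{v, u}` ends at `v` (`u ∉ Λ`).
* `exists_eq_concat_in`: a walk to the live port `{v, w₁}` containing `v` ends at `v` (it cannot
  leave `v` again: the exits lead to `w₁, w₂` only, and the walk must still stop on `{v, w₁}`
  without repeating a vertex or making a U-turn on its final mid-edge).
* `helper_walledPortsLastVertex`: the last two facts packaged as the registered sub-goal of the
  crux item served by this file.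
-/

noncomputable section

open scoped BigOperators
open Literature.Probability.LatticeModels Literature.Probability.RandomPlanarGeometry.SAW

namespace Summit.CriticalPhenomena.SAWScalingLimit.Theorems.SAWDevelopingMapNoFoldBound

namespace WalledPorts

/-! ### List lemmas -/

section Lists

variable {V : Type*}

/-- The consecutive pairs of `L ++ [w, v]` are those of `L ++ [w]` followed by `{w, v}`. -/
theorem edges_concat_concat (w v : V) : ∀ (L : List V),
    List.zipWith (fun b c => s(b, c)) (L ++ [w, v]) (L ++ [w, v]).tail =
      List.zipWith (fun b c => s(b, c)) (L ++ [w]) (L ++ [w]).tail ++ [s(w, v)]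
  | [] => rfl
  | [_] => rfl
  | z :: z' :: L => by
    have ih := edges_concat_concat w v (z' :: L)
    simp only [List.cons_append] at ih ⊢
    rw [edges_cons_cons, edges_cons_cons, ih, List.cons_append]

/-- `{x, y}` is a consecutive pair of `l₁ ++ x :: y :: l₂`. -/
theorem mem_edges_append_cons_cons (x y : V) (l₂ : List V) : ∀ (l₁ : List V),
    s(x, y) ∈ List.zipWith (fun b c => s(b, c)) (l₁ ++ x :: y :: l₂) (l₁ ++ x :: y :: l₂).tail
  | [] => by
    rw [List.nil_append, edges_cons_cons]
    exact List.mem_cons_self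
  | z :: l₁ => by
    have ih := mem_edges_append_cons_cons x y l₂ l₁
    obtain ⟨w, rest, hw⟩ : ∃ w rest, l₁ ++ x :: y :: l₂ = w :: rest :=
      List.exists_cons_of_ne_nil (by simp)
    rw [hw] at ih
    rw [List.cons_append, hw, edges_cons_cons]
    exact List.mem_cons_of_mem _ ih

end Lists

/-- A sum over a subtype of a finite type is the sum of the indicator-weighted function. -/
theorem sum_subtype_eq_sum_ite {ι : Type*} [Fintype ι] {M : Type*} [AddCommMonoid M]
    (p : ι → Prop) [DecidablePred p] (f : ι → M) :
    ∑ i : {i // p i}, f i = ∑ i, if p i then f i else 0 := by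
  rw [← Finset.sum_filter]
  exact (Finset.sum_subtype (Finset.univ.filter p) (fun x => by simp) f).symm

/-! ### First arrivals prolonged through `v` -/

variable {Λ : Finset HexVertex} {a : Sym2 HexVertex} {v w t : HexVertex}

/-- A walk to a mid-edge containing `v`, from a mid-edge `a ∌ v`, is nontrivial. -/
theorem verts_ne_nil {z : Sym2 HexVertex} (δ : HexMidEdgeSAW Λ a z) (hva : v ∉ a)
    (hvz : v ∈ z) : δ.verts ≠ [] :=
  fun h => hva (by rw [δ.eq_of_nil h]; exact hvz)

/-- A walk to `{v, w}` avoiding `v` ends at `w`. -/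
theorem getLast_eq_of_not_mem (δ : HexMidEdgeSAW Λ a s(v, w)) (hvδ : v ∉ δ.verts)
    (hne : δ.verts ≠ []) : δ.verts.getLast hne = w :=
  (δ.getLast_eq_or hne).resolve_left fun h => hvδ (by
    have hm := List.getLast_mem hne
    rwa [h] at hm)

/-- A walk to `{v, w}` avoiding `v`, from `a ∌ v`, ends at `w` (`getLast?` form). -/
theorem getLast?_eq (δ : HexMidEdgeSAW Λ a s(v, w)) (hva : v ∉ a) (hvδ : v ∉ δ.verts) :
    δ.verts.getLast? = some w := by
  have hne := verts_ne_nil δ hva (Sym2.mem_mk_left v w)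
  rw [List.getLast?_eq_some_getLast hne, getLast_eq_of_not_mem δ hvδ hne]

/-- A walk to `{v, w}` avoiding `v`, from `a ∌ v`, has vertex list `L ++ [w]`. -/
theorem exists_eq_concat (δ : HexMidEdgeSAW Λ a s(v, w)) (hva : v ∉ a) (hvδ : v ∉ δ.verts) :
    ∃ L, δ.verts = L ++ [w] := by
  have hne := verts_ne_nil δ hva (Sym2.mem_mk_left v w)
  refine ⟨δ.verts.dropLast, ?_⟩
  conv_lhs => rw [← List.dropLast_append_getLast hne]
  rw [getLast_eq_of_not_mem δ hvδ hne]

/-- Prolongation through `v ∈ Λ`: the vertices stay in `Λ`. -/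
theorem snoc_subset (δ : HexMidEdgeSAW Λ a s(v, w)) (hv : v ∈ Λ) :
    ∀ x ∈ δ.verts ++ [v], x ∈ Λ := by
  intro x hx
  rcases List.mem_append.1 hx with hx | hx
  · exact δ.subset x hx
  · rw [List.mem_singleton.1 hx]; exact hv

/-- Prolongation through `v`: no vertex is repeated (`v` was avoided). -/
theorem snoc_nodup (δ : HexMidEdgeSAW Λ a s(v, w)) (hvδ : v ∉ δ.verts) :
    (δ.verts ++ [v]).Nodup :=
  List.nodup_append.2 ⟨δ.nodup, List.nodup_singleton v, fun x hx y hy hxy =>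
    hvδ (by rw [List.mem_singleton.1 hy] at hxy; exact hxy ▸ hx)⟩

/-- Prolongation through `v`: consecutive vertices stay adjacent (`w ∼ v`). -/
theorem snoc_isChain (δ : HexMidEdgeSAW Λ a s(v, w)) (hva : v ∉ a) (hvw : hexGraph.Adj v w)
    (hvδ : v ∉ δ.verts) : (δ.verts ++ [v]).IsChain hexGraph.Adj :=
  List.IsChain.append δ.isChain (List.isChain_singleton v) fun x hx y hy => by
    rw [Option.mem_def, getLast?_eq δ hva hvδ, Option.some_inj] at hx
    rw [Option.mem_def, List.head?_cons, Option.some_inj] at hy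
    subst hx hy
    exact hvw.symm

/-- Prolongation through `v`: the first vertex is unchanged. -/
theorem snoc_head_mem (δ : HexMidEdgeSAW Λ a s(v, w)) (hva : v ∉ a) :
    ∀ x, (δ.verts ++ [v]).head? = some x → x ∈ a := fun x hx =>
  δ.head_mem x (by
    rwa [List.head?_append_of_ne_nil _ (verts_ne_nil δ hva (Sym2.mem_mk_left v w))] at hx)

/-- Prolongation through `v`: the last vertex `v` lies on every port `{v, t}`. -/
theorem snoc_getLast_mem (δ : HexMidEdgeSAW Λ a s(v, w)) :
    ∀ x, (δ.verts ++ [v]).getLast? = some x → x ∈ s(v, t) := by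
  intro x hx
  rw [List.getLast?_concat, Option.some_inj] at hx
  exact hx ▸ Sym2.mem_mk_left v t

/-- Prolongation through `v`: the vertex list is nonempty. -/
theorem snoc_eq_of_nil (δ : HexMidEdgeSAW Λ a s(v, w)) {z : Sym2 HexVertex} :
    δ.verts ++ [v] = [] → a = z :=
  fun h => absurd h (by simp)

/-- Prolongation through `v` towards another port `{v, t}`, `t ≠ w`: the new edge `{w, v}` and
the final half-edge `{v, t}` are fresh, so no edge is used twice. -/
theorem snoc_edges_nodup (δ : HexMidEdgeSAW Λ a s(v, w)) (hva : v ∉ a) (htw : t ≠ w)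
    (hvδ : v ∉ δ.verts) :
    (a :: List.zipWith (fun b c => s(b, c)) (δ.verts ++ [v]) (δ.verts ++ [v]).tail ++
      [s(v, t)]).Nodup := by
  obtain ⟨L, hL⟩ := exists_eq_concat δ hva hvδ
  have hed := δ.edges_nodup (verts_ne_nil δ hva (Sym2.mem_mk_left v w))
  rw [hL, List.cons_append] at hed
  rw [hL, List.append_assoc, List.singleton_append, edges_concat_concat,
    show s(w, v) = s(v, w) from Sym2.eq_swap, List.cons_append]
  refine List.nodup_append.2 ⟨hed, List.nodup_singleton _, ?_⟩
  intro e he y hy hey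
  rw [List.mem_singleton] at hy
  rw [hy] at hey
  rw [hey] at he
  rcases List.mem_cons.1 he with h | h
  · exact hva (h ▸ Sym2.mem_mk_left v t)
  · rcases List.mem_append.1 h with h | h
    · exact hvδ (by rw [hL]; exact forall_mem_of_mem_edges _ _ h v (Sym2.mem_mk_left v t))
    · exact htw (Sym2.congr_right.1 (List.mem_singleton.1 h))

/-- **Multiplicativity of the weight.** If the walk `γ : a → {v, t}` is the walk `δ : a → {v, w}`
(`a ∌ v`) followed by `v`, then `ℓ(γ) = ℓ(δ) + 1` and
`W(γ) = W(δ) + W(mid{w,v} → c(v) → mid{v,t})` (the last half-segment of `δ` is collinear with the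
edge `w v`), so `weight(γ) = x e^{-iσ W(mid{w,v} → c(v) → mid{v,t})} · weight(δ)`. -/
theorem weight_eq_of_verts_eq_concat (γ : HexMidEdgeSAW Λ a s(v, t))
    (δ : HexMidEdgeSAW Λ a s(v, w)) (hva : v ∉ a) (hγδ : γ.verts = δ.verts ++ [v]) (x σ : ℝ) :
    γ.weight x σ =
      (x : ℂ) * Complex.exp (-Complex.I * σ *
          (winding [hexMidpoint s(w, v), hexCenter v, hexMidpoint s(v, t)] : ℝ)) *
        δ.weight x σ := by
  have hvδ : v ∉ δ.verts := by
    have hnd := γ.nodup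
    rw [hγδ] at hnd
    exact fun h => (List.nodup_append.1 hnd).2.2 v h v (List.mem_singleton_self v) rfl
  obtain ⟨L, hLw⟩ := exists_eq_concat δ hva hvδ
  -- lengths
  have hlen : γ.length = δ.length + 1 := by
    rw [HexMidEdgeSAW.length, HexMidEdgeSAW.length, hγδ, List.length_append,
      List.length_singleton]
  -- windings
  have hmid : hexMidpoint s(v, w) =
      hexCenter w + (1 / 2 : ℝ) * (hexCenter v - hexCenter w) := by
    rw [hexMidpoint_mk]; push_cast; ring
  have hmid' : hexMidpoint s(w, v) =
      hexCenter v + (1 / 2 : ℝ) * (hexCenter w - hexCenter v) := by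
    rw [hexMidpoint_mk]; push_cast; ring
  have e1 : γ.points = (hexMidpoint a :: L.map hexCenter) ++
      [hexCenter w, hexCenter v, hexMidpoint s(v, t)] := by
    simp [HexMidEdgeSAW.points, hγδ, hLw]
  have e2 : δ.points =
      (hexMidpoint a :: L.map hexCenter) ++ [hexCenter w, hexMidpoint s(v, w)] := by
    simp [HexMidEdgeSAW.points, hLw]
  have hW : γ.winding =
      δ.winding + winding [hexMidpoint s(w, v), hexCenter v, hexMidpoint s(v, t)] := by
    rw [HexMidEdgeSAW.winding, HexMidEdgeSAW.winding, e1, e2, hmid,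
      winding_concat_right_ray (t := 1 / 2) (by norm_num), winding_concat₃, hmid',
      winding_cons_cons_cons, HV.turning_left_ray (by norm_num), winding_pair, add_zero]
  rw [HexMidEdgeSAW.weight, HexMidEdgeSAW.weight, hW, hlen, Complex.ofReal_add, mul_add,
    Complex.exp_add, pow_succ]
  ring

/-- The weight of the prolongation through `v` of a first arrival `δ` through `w`, as a walk to
the port `{v, t}` (anonymous-constructor form, for rewriting inside sums). -/
theorem weight_mk_concat (δ : HexMidEdgeSAW Λ a s(v, w)) (hva : v ∉ a) (h₁ h₂ h₃ h₄)
    (h₅ : ∀ x, (δ.verts ++ [v]).getLast? = some x → x ∈ s(v, t)) (h₆ h₇ h₈) (x σ : ℝ) :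
    HexMidEdgeSAW.weight (⟨δ.verts ++ [v], h₁, h₂, h₃, h₄, h₅, h₆, h₇, h₈⟩ :
        HexMidEdgeSAW Λ a s(v, t)) x σ =
      (x : ℂ) * Complex.exp (-Complex.I * σ *
          (winding [hexMidpoint s(w, v), hexCenter v, hexMidpoint s(v, t)] : ℝ)) *
        δ.weight x σ :=
  weight_eq_of_verts_eq_concat _ δ hva rfl x σ

/-! ### Walks ending at `v` -/

/-- **Removing the final vertex `v`.** A walk `γ` from `a ∌ v` to a port `{v, t}` whose last
vertex is `v` enters `v` from a neighbour `y ∈ Λ` with `y ≠ t` (no U-turn on the final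
mid-edge), and dropping `v` leaves a walk to `{v, y}` avoiding `v`. -/
theorem exists_init (γ : HexMidEdgeSAW Λ a s(v, t)) (hva : v ∉ a) {L : List HexVertex}
    (hL : γ.verts = L ++ [v]) :
    ∃ y, hexGraph.Adj v y ∧ y ∈ Λ ∧ y ≠ t ∧
      ∃ δ : HexMidEdgeSAW Λ a s(v, y), v ∉ δ.verts ∧ γ.verts = δ.verts ++ [v] := by
  -- `v` is not the first vertex
  have hLne : L ≠ [] := by
    rintro rfl
    exact hva (γ.head_mem v (by simp [hL]))
  obtain ⟨L', y, rfl⟩ := (List.eq_nil_or_concat' L).resolve_left hLne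
  have hL2 : γ.verts = L' ++ [y, v] := by rw [hL, List.append_assoc]; rfl
  -- no repeated vertex
  have hnd := γ.nodup
  rw [hL] at hnd
  obtain ⟨hnd', -, hdis⟩ := List.nodup_append.1 hnd
  have hvL : v ∉ L' ++ [y] := fun h => hdis v h v (List.mem_singleton_self v) rfl
  -- adjacency
  have hch := γ.isChain
  rw [hL2] at hch
  obtain ⟨hch', hyv, -⟩ := List.isChain_append_cons_cons.1 hch
  have hyΛ : y ∈ Λ := γ.subset y (by simp [hL])
  -- edges
  have hed := γ.edges_nodup (by simp [hL])
  rw [hL2, edges_concat_concat] at hed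
  obtain ⟨hed', -, hdis'⟩ := List.nodup_append.1 hed
  have hyt : y ≠ t := by
    rintro rfl
    exact hdis' _ (List.mem_cons_of_mem a (List.mem_append_right _ (List.mem_singleton_self _)))
      _ (List.mem_singleton_self _) Sym2.eq_swap
  refine ⟨y, hyv.symm, hyΛ, hyt, ⟨L' ++ [y], fun x hx => γ.subset x ?_, hnd', hch',
    fun x hx => ?_, fun x hx => ?_, fun h => absurd h (by simp), fun _ => ?_, γ.fst_mem⟩,
    hvL, hL⟩
  · rw [hL]; exact List.mem_append_left _ hx
  · refine γ.head_mem x ?_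
    rw [hL, List.head?_append_of_ne_nil _ (by simp)]
    exact hx
  · rw [List.getLast?_concat, Option.some_inj] at hx
    exact hx ▸ Sym2.mem_mk_right v y
  · rw [show s(v, y) = s(y, v) from Sym2.eq_swap, List.cons_append]
    exact hed'

variable {u w₁ w₂ : HexVertex}

/-- A walk from `a ∌ v` to the walled port `{v, u}` (`u ∉ Λ`) ends at `v`. -/
theorem exists_eq_concat_out (hu : u ∉ Λ) (hva : v ∉ a) (γ : HexMidEdgeSAW Λ a s(v, u)) :
    ∃ L, γ.verts = L ++ [v] := by
  have hne := verts_ne_nil γ hva (Sym2.mem_mk_left v u)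
  refine ⟨γ.verts.dropLast, ?_⟩
  conv_lhs => rw [← List.dropLast_append_getLast hne]
  rcases γ.getLast_eq_or hne with h | h
  · rw [h]
  · exact absurd (h ▸ γ.subset _ (List.getLast_mem hne)) hu

/-- **A walk from `a ∌ v` to the live port `{v, w₁}` passing through `v` ends at `v`.**
Otherwise `v` sits strictly inside the walk, between its two neighbours `w₁, w₂` in `Λ` (the
third neighbour `u` lies outside), and the walk ends at `w₁ ≠ v`: if `v` was entered from `w₁`
the vertex `w₁` is repeated, and if `v` is left towards `w₁` the walk must stop there, having
used the edge `{v, w₁}` that is also its final half-edge — a U-turn. -/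
theorem exists_eq_concat_in (hu : u ∉ Λ) (hva : v ∉ a) (huv : hexGraph.Adj v u)
    (h₁ : hexGraph.Adj v w₁) (h₂ : hexGraph.Adj v w₂) (hu₁ : u ≠ w₁) (hu₂ : u ≠ w₂)
    (h₁₂ : w₁ ≠ w₂) (γ : HexMidEdgeSAW Λ a s(v, w₁)) (hvγ : v ∈ γ.verts) :
    ∃ L, γ.verts = L ++ [v] := by
  obtain ⟨L₁, L₂, hL⟩ := List.append_of_mem hvγ
  rcases L₂ with _ | ⟨q, L₂⟩
  · exact ⟨L₁, hL⟩
  exfalso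
  -- `v` is not the first vertex: it has a predecessor `p`
  have hL₁ : L₁ ≠ [] := by
    rintro rfl
    exact hva (γ.head_mem v (by simp [hL]))
  obtain ⟨L₀, p, rfl⟩ := (List.eq_nil_or_concat' L₁).resolve_left hL₁
  have hL' : γ.verts = L₀ ++ p :: v :: q :: L₂ := by rw [hL]; simp
  -- adjacency
  have hch := γ.isChain
  rw [hL'] at hch
  have hch3 : List.IsChain hexGraph.Adj (p :: v :: q :: L₂) := hch.right_of_append
  have hpv : hexGraph.Adj p v := (List.isChain_cons_cons.1 hch3).1
  have hvq : hexGraph.Adj v q := (List.isChain_cons_cons.1 (List.isChain_cons_cons.1 hch3).2).1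
  -- distinctness
  have hnd := γ.nodup
  rw [hL'] at hnd
  have hnd3 : (p :: v :: q :: L₂).Nodup := (List.nodup_append.1 hnd).2.1
  have hp : p ∉ v :: q :: L₂ := (List.nodup_cons.1 hnd3).1
  have hnd2 : (v :: q :: L₂).Nodup := (List.nodup_cons.1 hnd3).2
  have hv' : v ∉ q :: L₂ := (List.nodup_cons.1 hnd2).1
  have hnd1 : (q :: L₂).Nodup := (List.nodup_cons.1 hnd2).2
  have hpq : p ≠ q := fun h => hp (h ▸ List.mem_cons_of_mem v List.mem_cons_self)
  -- membership in `Λ`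
  have hpΛ : p ∈ Λ := γ.subset p (by simp [hL'])
  have hqΛ : q ∈ Λ := γ.subset q (by simp [hL'])
  -- the last vertex is `w₁`, and it lies in `q :: L₂`
  have hne : γ.verts ≠ [] := by simp [hL']
  have hzmem : (q :: L₂).getLast (List.cons_ne_nil q L₂) ∈ q :: L₂ := List.getLast_mem _
  have hzlast : γ.verts.getLast? = some ((q :: L₂).getLast (List.cons_ne_nil q L₂)) := by
    rw [hL', List.getLast?_append_of_ne_nil _ (List.cons_ne_nil _ _), List.getLast?_cons_cons,
      List.getLast?_cons_cons]
    exact List.getLast?_eq_some_getLast _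
  have hzw : (q :: L₂).getLast (List.cons_ne_nil q L₂) = w₁ := by
    rcases Sym2.mem_iff.1 (γ.getLast_mem _ hzlast) with h | h
    · exact absurd (h ▸ hzmem) hv'
    · exact h
  -- `p, q ∈ {w₁, w₂}`
  have hp' : p = w₁ ∨ p = w₂ := by
    rcases SourceLoopBound.eq_or_eq_or_eq_of_adj huv h₁ h₂ hu₁ hu₂ h₁₂ hpv.symm with h | h
    · exact absurd (h ▸ hpΛ) hu
    · exact h
  have hq' : q = w₁ ∨ q = w₂ := by
    rcases SourceLoopBound.eq_or_eq_or_eq_of_adj huv h₁ h₂ hu₁ hu₂ h₁₂ hvq with h | h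
    · exact absurd (h ▸ hqΛ) hu
    · exact h
  rcases hp' with hp1 | hp2
  · -- entered from `w₁`: then `w₁ = p` is repeated as the last vertex
    refine hp (List.mem_cons_of_mem v ?_)
    rw [hp1, ← hzw]
    exact hzmem
  · -- entered from `w₂`, hence left towards `q = w₁`, where the walk stops: a U-turn
    have hq1 : q = w₁ := by
      rcases hq' with h | h
      · exact h
      · exact absurd (hp2.trans h.symm) hpq
    have hL₂ : L₂ = [] := by
      by_contra hL₂
      refine (List.nodup_cons.1 hnd1).1 ?_
      have hzL : (q :: L₂).getLast (List.cons_ne_nil q L₂) ∈ L₂ := by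
        rw [List.getLast_cons hL₂]; exact List.getLast_mem hL₂
      rw [hzw, ← hq1] at hzL
      exact hzL
    subst hL₂
    have hed := γ.edges_nodup hne
    rw [hL'] at hed
    have hmem : s(v, q) ∈ List.zipWith (fun b c => s(b, c)) (L₀ ++ p :: v :: [q])
        (L₀ ++ p :: v :: [q]).tail := by
      have h := mem_edges_append_cons_cons v q [] (L₀ ++ [p])
      rwa [List.append_assoc, List.singleton_append] at h
    obtain ⟨-, -, hdis⟩ := List.nodup_append.1 hed
    exact hdis _ (List.mem_cons_of_mem a hmem) _ (List.mem_singleton_self _) (by rw [hq1])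

end WalledPorts

/-- **Registered sub-goal `helper_walledPortsLastVertex`** (helpers 1/2 of the stub
`stub_walledPorts`): at a walled vertex `v` (`u ∉ Λ` a neighbour, `v ∉ a`, `w₁, w₂` the other
neighbours), every walk from `a` to the walled port `{v, u}` ends at `v`, and so does every walk
from `a` to the live port `{v, w₁}` that contains `v`. -/
theorem helper_walledPortsLastVertex :
    ∀ (Λ : Finset HexVertex) (a : Sym2 HexVertex) (u v w₁ w₂ : HexVertex), u ∉ Λ → v ∉ a →
      hexGraph.Adj v u → hexGraph.Adj v w₁ → hexGraph.Adj v w₂ → u ≠ w₁ → u ≠ w₂ → w₁ ≠ w₂ →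
      (∀ γ : HexMidEdgeSAW Λ a s(v, u), ∃ L, γ.verts = L ++ [v]) ∧
        ∀ γ : HexMidEdgeSAW Λ a s(v, w₁), v ∈ γ.verts → ∃ L, γ.verts = L ++ [v] :=
  fun _ _ _ _ _ _ hu hva huv h₁ h₂ hu₁ hu₂ h₁₂ =>
    ⟨WalledPorts.exists_eq_concat_out hu hva,
      WalledPorts.exists_eq_concat_in hu hva huv h₁ h₂ hu₁ hu₂ h₁₂⟩

end Summit.CriticalPhenomena.SAWScalingLimit.Theorems.SAWDevelopingMapNoFoldBound
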